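import Mathlib
import HarnessLib
import HarnessLib.Audit
import Summits.AtomisticToContinuum.Statement
import Literature.MathematicalPhysics.QuantumManyBody.PeriodicBoseGas

/-!
Route: BECVortexSheetDuality

CLOSED (retired) 2026-08-15T13:41:05Z by operator:999:1257524 — reason: not-a-thesis: assembly does not conclude the sub-problem Statement — note: D-0027 §2.1 audit (human 2026-08-15: routes that do not decide the summit are removed): the assembly concludes `Literature.MathematicalPhysics.QuantumManyBody.BoseGas.BoseEinsteinCondensation`, not the sub-problem statement; a NEW conforming route may be opened from the same idea (generated `closes . The file is kept as the record of this route; refuted decls are indexed as negative knowledge (`ledger negatives`).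

# Route BECVortexSheetDuality — worm-end deconfinement — coarse-grain once to the healing scale,
then (3+1)-D Villain-current long-range order by vortex-sheet duality at stiffness (ρa³)^(-1/2)

It suffices to show X = X_eng ∧ X_tr ∧ X_bc (realises card vortex-sheet-duality; absorbs the retired
duplicate signfree-current-duality).
X_eng (decl VillainCurrentLRO, the card's B2 made the FIRST crux): the (3+1)-dimensional
integer-current ("J-current", WallinEtAl1994) Villain model on the torus (ℤ/(M+1))³ × ℤ/(T+1) —
currents J_b ∈ ℤ on oriented nearest-neighbour bonds, zero divergence, bond weights
exp(−J_b²/(2κ_b)) with INHOMOGENEOUS, arbitrarily ANISOTROPIC stiffnesses κ_b ∈ [K_i, ΛK_i] (i =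
direction of b), all K_i ≥ K₀(Λ) — has uniform equal-time long-range order of the worm two-point
function: Σ_{x,y} Z(δ_{(x,0)} − δ_{(y,0)}) ≥ c(Λ)·(M+1)⁶·Z(0), uniformly in M, T and κ. (By the
exact Fourier duality Σ_m e^{−κ(φ+2πm)²/2} ∝ Σ_J e^{−J²/(2κ)}e^{iJφ} this is spontaneous
magnetisation of the inhomogeneous Villain rotor model, ⟨cos(θ_x−θ_y)⟩ block-averaged.)
X_tr (decl HealingScaleTransfer, the card's B1+B3): X_eng ⇒ PeriodicBEC, i.e. constant-mode
condensation ≥ cN for δ-near-minimisers of the periodic N-body energy on the torus of side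
(N/ρ)^{1/3} at all small densities (verbatim the body of BECPeriodicReduction.PeriodicBEC,
stmt-AtomisticToContinuum-0826). Mechanism: coarse-grain ONCE to cells of Fournais's side ℓ =
C_L(ρa³)^{−δ}(ρa)^{−1/2} (inside which condensation is the PROVED fact Fournais2020_condensation)
and represent the imaginary-time gas as a POSITIVE-weight cell-current model in the class of X_eng
with stiffness K ≍ (8π)^{−1/2}C_L²(ρa³)^{−1/2−2δ} → ∞; worm-end deconfinement of that model is
constant-mode occupation.
X_bc (decl BoundaryTransferWeak, shared verbatim with BECPeriodicReduction
stmt-AtomisticToContinuum-0827): periodic condensation ⇒ the Dirichlet, mode-free HasGroundStateBEC.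
Lean: `VillainCurrentLRO ∧ HealingScaleTransfer ∧ BoundaryTransferWeak`

## Assembly
Pure logic (term in Sketch.lean, rc 0): given h₂ : VillainCurrentLRO, h₃ : HealingScaleTransfer, h₄
: BoundaryTransferWeak, for v repulsive finite-range, h₄ v hv (h₃ h₂ v hv) is exactly the body of
BoseEinsteinCondensation (∃ρ₀>0 ∀ρ∈(0,ρ₀) HasGroundStateBEC v ρ). The conjunct is reached through
Literature.MathematicalPhysics.QuantumManyBody.BoseGas.BoseEinsteinCondensation (= the sub-problem
abbrev).

Rationale: WHY THIS LINE. In every positive-weight world-line representation of the Bose gas the one-particle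
density matrix is the two-point function of ONE open world-line, so BEC is worm-end deconfinement;
after one super-renormalisable coarse-graining step to the healing scale the cell charges and face
currents form a conserved integer current whose leading action is the Villain/J-current model
(WallinEtAl1994) at dimensionless stiffness K ≍ (ℓ/ξ)²(ρa³)^{−1/2} — DILUTENESS IS STIFFNESS. Deep
in the ordered phase of a (3+1)-D abelian model, long-range order is a matter of abelian duality
plus an energy–entropy (Peierls) bound on the dual defects, here ℤ-valued vortex WORLD-SHEETS of
tension ∝ K (FrohlichSpencerCMP1982, Guth1980, KennedyKing1986; RP-free modern cousins
GarbanSpencer2022, DarioGarban2025), with expansion parameter the sheet fugacity e^{−cK} =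
exp(−c(ρa³)^{−1/2}) instead of an infrared RG flow to the Bogoliubov fixed point (Benfatto1994,
BalabanEtAl2010 = route BECRenormGroup). Imported areas, with the card's explicit dictionary
(world-lines ↦ conserved integer currents; γ(x,y) ↦ worm two-point function; BEC ↦ magnetisation of
the dual phase; healing length ↦ lattice spacing; quantised vortex rings ↦ vortex sheets; depletion
↦ O(1/K)): lattice gauge/spin duality and defect expansions (constructive field theory), the physics
J-current representation of lattice bosons, and the proved cell theorems of the dilute gas
(Fournais2020, LiebSeiringerSolovejYngvason2005 Thm 2.4 / Lemma 5.2 — all with _holds proofs in the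
tree). What no prior route does: BECRenormGroup flows to a non-trivial fixed point in a COMPLEX
representation; BECInfraredBound wants an infrared bound with no positivity to derive it from;
BECPinning stays in the energy currency; here the infrared step is a soft topological argument in a
positive representation, entered at the one scale where condensation is already a theorem. Negatives
index: empty at filing.

RANKED CRUXES. #2 VillainCurrentLRO (crux) — ENGINE (Literature-grade, independent of the Bose gas;
card item B2 widened to what a one-step coarse-graining produces). For every inhomogeneity ratio Λ ≥
1 there are K₀, c > 0 such that for all M, T, every direction-wise base stiffness K_i ≥ K₀ (i ∈ Fin
4; arbitrary anisotropy between directions) and every bond stiffness field κ with K_i ≤ κ_{x,i} ≤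
ΛK_i, the Villain integer-current model on (ℤ/(M+1))³ × ℤ/(T+1) (weights Π
exp(−J_{x,i}²/(2κ_{x,i})), divergence Σ_i (J_{x,i} − J_{x−e_i,i})) satisfies Σ_{x,y ∈ (ℤ/(M+1))³}
Z(δ_{(x,0)} − δ_{(y,0)}) ≥ c (M+1)⁶ Z(0). Z(q) = sum over currents of divergence q, an ENNReal tsum;
Z(0) ∈ [1, ∞). Stiffness is required large in EVERY direction, so each time-slab is already an
ordered 3-D Villain model and no T → ∞ ordering of limits arises (T+1 = 1 is the 3-D model of
FrohlichSpencerCMP1982). Stated for n-INDEPENDENT κ on purpose: n-dependent "Villain sandwiches" are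
refutable (parity-modulated weights dualise to XY × a ℤ₂ loop gas of K-independent fugacity 1/√Λ,
disordered in 4-D for Λ ≳ 45 — pair superfluid without worm LRO; planner's NOTES). [difficulty: L]
(why it might fail: No reflection positivity for inhomogeneous κ; duality+Peierls (FS82, Guth,
Kennedy–King) is printed only for homogeneous isotropic models, so Λ- and anisotropy-uniform
constants are unproved; Ginibre monotonicity, which would reduce to the homogeneous case, is not
known for Villain weights.) [FrohlichSpencerCMP1982, Guth1980, KennedyKing1986, GarbanSpencer2022,
DarioGarban2025, FrohlichSimonSpencer1976, WallinEtAl1994]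
#3 HealingScaleTransfer (crux) — THE BET (card items B1 + B3, stated conditionally so the assembly
is pure logic): VillainCurrentLRO ⇒ PeriodicBEC (body verbatim = BECPeriodicReduction.PeriodicBEC,
stmt-AtomisticToContinuum-0826: ∀ repulsive finite-range v ∃ρ₀ ∀ρ<ρ₀ ∃c ∀ᶠN ∃δ, every
δ-near-minimiser of periodicEnergy on the torus of side (N/ρ)^{1/3} has condensateOccupation ≥ cN).
Intended proof: (i) coarse-grain the imaginary-time periodic gas (ground state = β → ∞ at fixed N, L
first) into M³ cells of Fournais side ℓ = C_L(ρa³)^{−δ}(ρa)^{−1/2}, M = L/ℓ → ∞, and time-slabs τ₀ =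
θ(E_J E_C)^{−1/2} (E_J ≍ ρℓ Josephson coupling per face, E_C ≍ 8πa/ℓ³ charging energy; mean
occupation n̄ = ρℓ³ = C_L³(ρa³)^{−1/2−3δ} ≫ 1, rotor regime) — cell charges and face-crossing counts
are a conserved integer current whose law is a POSITIVE push-forward of the Feynman–Kac/occupation
measure; (ii) show its weights are bondwise Villain with stiffnesses K_s = E_Jτ₀, K_t = 1/(E_Cτ₀),
K_sK_t = K² ≍ (8π)^{−1}C_L⁴(ρa³)^{−1−4δ}, up to corrections that keep the class of VillainCurrentLRO
(inputs, all PROVED in the tree: Fournais2020_condensation_holds for intra-cell condensation,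
LSSY2005_lemma52_periodic_holds / LSSY2005_lowerBound_neumann_holds /
LSSY2005_upperBound_periodic_holds for the energy budget 4πaρn(1 + O(Y^{1/17})) per cell, which
forces Fournais's ε ≥ 15/34 and δ < 1/34 — enough for K → ∞); (iii) equal-time worm block-LRO ⇒
Σ_{B,B'}⟨χ_B, γ_Ψ χ_{B'}⟩ ≥ c n̄ M⁶·M^{−3}… = c'N for the cell indicators, i.e. condensateOccupation
≥ c'N, transferred from β = ∞ to δ-near-minimisers by the fixed-(N,L) spectral gap. Foreseen tenure
split: PositiveCellCurrentRepresentation → (engine widened to the delivered class) →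
HealingScaleTransfer. [deps: VillainCurrentLRO] [difficulty: open-problem] (why it might fail:
Integrating out intra-cell modes (Schur complement) need not keep cell-current weights POSITIVE and
bondwise-Villain: complex weights at relative order (ξ/ℓ)² return BFKT's large-field problem; cell
gap c/ℓ ≈ Josephson frequency gives temporal memory; Neumann-cell BEC (Junge2026) not vendored.)
[BalabanEtAl2010, Benfatto1994, WallinEtAl1994, Fournais2020, LiebSeiringerSolovejYngvason2005,
Junge2026, FrohlichSpencerCMP1982,
Literature.Barriers.AtomisticToContinuum.BogoliubovPerturbationInfrared]
#4 BoundaryTransferWeak (crux) — SHARED verbatim with route BECPeriodicReduction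
(stmt-AtomisticToContinuum-0827; one proof serves both): for each repulsive finite-range v,
PeriodicBEC(v) ⇒ ∃ρ₀>0 ∀ρ∈(0,ρ₀) HasGroundStateBEC v ρ (Dirichlet ground state, mode-free λ_max(γ) ≥
cN via condensateNumber). This card is indifferent to boundary conditions beyond this item (its
engine could also be run directly in the Dirichlet box with free spatial boundary of the current
lattice — deliberately not filed). [deps: HealingScaleTransfer] [difficulty: L] (why it might fail:
PeriodicBEC(v) is ground-state-only at the box (N/ρ)^{1/3}: the Dirichlet ground state is a periodic
trial state but lies a wall term ≫ δ above E₀^per and interior restrictions are neither periodic nor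
of sharp N, so the hypothesis may never fire; BEC is BC-sensitive (Robinson1976).)
[LiebSeiringerSolovejYngvason2005, Junge2026, Basti2022, BoccatoSeiringer2023, Robinson1976,
LauwersVerbeureZagrebnov2003]
#9 HomogeneousVillainLRO (support) — MILESTONE 0 of the engine (the Λ = 1, translation-invariant
case; Sketch.lean proves VillainCurrentLRO → HomogeneousVillainLRO): for direction-wise constant
stiffnesses K_i ≥ K₀ (anisotropy free) the (3+1)-D Villain current model has the same uniform
equal-time block long-range order. Closest to print: FrohlichSpencerCMP1982 (d ≥ 3 isotropic
Villain, duality + energy–entropy of defects), Guth1980 (the dual 4-D U(1) statement); the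
anisotropy-uniform bookkeeping (every slab ordered because every K_i ≥ K₀) is the only addition. A
prover may land it as a Literature fact + proof under Literature/Probability/LatticeModels and cite
it here. [difficulty: L] [FrohlichSpencerCMP1982, Guth1980, KennedyKing1986, Wojtkiewicz2012]

TWO-LAYER PLAN. Foreseen glued splits (none filed now; k ≤ 3, depth 1): HealingScaleTransfer ⇐
PositiveCellCurrentRepresentation (the periodic gas at density ρ < ρ₀ dominates, cell-block by
cell-block, the equal-time worm two-point function of a positive cell-current model in an explicit
class 𝒱 with all stiffnesses ≥ K(ρ) → ∞) → EngineForDeliveredClass (VillainCurrentLRO widened from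
pure Villain to 𝒱, e.g. bondwise log-weights −J²/(2κ_b) + u_b(J) with |u_b(J)| ≤ ε(1 + J²/κ_b), u_b
even — unimodal duals only) → HealingScaleTransfer. VillainCurrentLRO ⇐ HomogeneousVillainLRO
(support, already filed) → InhomogeneityByDuality (Λ-uniform Peierls constants for the dual ℤ-valued
2-form gas over an inhomogeneous massless Gaussian) → VillainCurrentLRO. BoundaryTransferWeak: owned
by BECPeriodicReduction (Neumann bracketing + mode-free criterion), not split here.

KILL CRITERIA. K1: VillainCurrentLRO refuted by an explicit stiffness field (block order → 0 at
arbitrarily large K₀ for some Λ) ⇒ restate with the homogeneity the periodic gas actually has (Λ = 1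
+ o(1) per direction) or close refuted:VillainCurrentLRO if even HomogeneousVillainLRO dies. K2: the
CHEAPEST FALSIFIER below returns a negative or complex second-order effective current weight at
relative order (ξ/ℓ)² that no choice of cell variables/time-slab removes ⇒ HealingScaleTransfer is
back in BFKT's complex large-field class; close as superseded by route BECRenormGroup (the card says
so itself). K3: the effective weights are positive but parity-modulated (pair hopping comparable to
single hopping at scale ℓ) ⇒ the engine class has no worm LRO (ℤ₂ loop-gas obstruction, NOTES) ⇒
close refuted unless a different cell scale cures it. K4: BoundaryTransferWeak refuted ⇒ shared
pivot with BECPeriodicReduction (run the engine in the Dirichlet box with a free spatial boundary of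
the current lattice; the engine's inhomogeneity allowance was kept partly for this). PeriodicBEC
proved by any other route moots HealingScaleTransfer (it becomes the constant function of its
hypothesis) but not the engine items, which stay Literature-grade.

NOT DECOMPOSED YET. The interior of HealingScaleTransfer: the cell-current REPRESENTATION as a Lean
object (needs a Feynman–Kac / occupation-current path-measure vocabulary for the periodic Bose gas —
same missing layer as BECRenormGroup's cruxes 0692–0695 and the Feynman–Kac cards; requested
informally below), the Schur-complement positivity estimate, the choice of time-slab θ, the
Neumann-vs-periodic cell input (Junge2026 Cor. 6 / FournaisEtAl2024 Thm 1.3 are the printed Neumann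
tools; only the periodic Fournais2020 theorem is vendored and proved), the β = ∞ ↔ δ-near-minimiser
transfer at fixed (N, L), and the widening of the engine to non-Villain bondwise or weakly
multi-bond weights (layer-2 child EngineForDeliveredClass; NOT the naive 'Villain sandwich', which
is false). Positive temperature, 2-D, and the direct Dirichlet version of the engine are out of
scope.

CHEAPEST FALSIFIER. (a) The card's dimer test, hours of kit py: two Gross–Pitaevskii cells (two-mode
Bose–Hubbard dimer, n̄ ≫ 1, E_J/E_C ≍ K²) plus ONE intra-cell Bogoliubov mode; integrate the mode
out over a time-slab τ₀ = θ(E_JE_C)^{−1/2} for θ ∈ {1/4, 1, 4} and read off the effective weight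
w(J) of transferring J particles: is it positive, even, and log-concave in J with −log w(J) =
J²/(2E_Jτ₀)(1 + O((ξ/ℓ)²)) — or does a negative/complex correction appear at relative order (ξ/ℓ)²?
A negative weight retires HealingScaleTransfer as stated (K2). (b) A refuter reads
FrohlichSpencerCMP1982 §§ on the Villain model in d ≥ 3 for whether the defect expansion's constants
are uniform under bondwise stiffness changes within [K, ΛK] (if the printed argument needs exact
translation invariance, VillainCurrentLRO is 'heavy' and HomogeneousVillainLRO is the realistic
first landing). (c) Lookup: a printed Ginibre inequality for Villain weights would make
VillainCurrentLRO ⇐ HomogeneousVillainLRO immediate (Bricmont–Fontaine-type correlation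
inequalities; not found this session — searchd/galaxy unavailable, crossref only).

NUMBERS. ξ = (8πρa)^{−1/2} (healing length, units ħ = 2m = 1); ℓ = C_L(ρa³)^{−δ}(ρa)^{−1/2}
(Fournais2020 (1.7)) so ℓ/ξ = √(8π)C_L(ρa³)^{−δ}; n̄ = ρℓ³ = C_L³(ρa³)^{−1/2−3δ}; E_J ≍ ρℓ, E_C ≍
8πa/ℓ³, K = √(E_J/E_C) ≍ ρξℓ²·const = (8π)^{−1/2}C_L²(ρa³)^{−1/2−2δ}; Fournais depletion per cell
n₊/n ≤ C C_L²(ρa³)^{1/2−ε−2δ} (needs 2δ + ε < 1/2); with only the PROVED energy inputs (LY lower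
bound, relative error Y^{1/17}, Y = 4πρa³/3; LSSY Thm 2.2 upper bound, relative error O(Y^{1/3}))
the usable Fournais exponent is ε ≥ 1/2 − 1/17, hence δ < 1/34 — still ℓ/ξ → ∞ and K → ∞. Engine
side: spin-wave depletion of the 4-D Villain model = O(1/K) uniformly in anisotropy (∫d⁴p/(K_tp_t² +
K_s|p_s|²) ∝ (K_tK_s)^{−1/2} when both are large); parity obstruction threshold for n-dependent
weights: ℤ₂ loop fugacity 1/√Λ against 4-D Ising tanh β_c ≈ 0.148, i.e. Λ ≳ 45. Items at open: 5 (3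
cruxes, 1 support, 1 assembly).

DEFINITION REQUESTS. (1) VillainCurrentModel (topic Literature/Probability/LatticeModels): integer
1-currents on (ℤ/M)^d-type tori with prescribed divergence, bondwise Villain weights, Z(q) as an
ENNReal tsum, worm two-point G(x,y) = Z(δ_x−δ_y)/Z(0), and the Fourier-duality identity with the
Villain rotor model ⟨cos(θ_x−θ_y)⟩ — would shorten VillainCurrentLRO/HomogeneousVillainLRO to one
line each and serve cards josephson-rotor-skeleton, integer-block-rotor-rp, sync-instead-of-rp
(filed with --for the engine item). (2) Informally (not filed, shared need with BECRenormGroup and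
the Feynman–Kac cards): a positive path-measure / occupation-current representation of e^{−βH} for
the periodic N-body Bose gas (Ginibre loop gas; KonigVogelZass2025 for the free gas), without which
PositiveCellCurrentRepresentation cannot be typed. (3) Cite fact wanted: Junge2026 Thm 4 / Cor. 6
(Neumann-box condensation up to R ~ a(ρa³)^{−3/4−η}) as a named Literature Prop next to
Fournais2020_condensation.

Novelty: Searches (2026-08-15, this session; local searchd DOWN (connection reset), OpenAlex and arXiv HTTP
429, zbMATH 0 rows, galaxy --star all queued > 90 s; crossref answered): lit frontier
AtomisticToContinuum --since 2020 (30 rows: Bose-gas descendants arXiv:2603.20776 Junge2026,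
arXiv:2510.20493 ChongLiangNam2026, arXiv:2602.16566 — none uses duality or a current
representation); lit bridges AtomisticToContinuum --cross any (30 rows; no Bose-gas/lattice-duality
bridge; nearest arXiv:2002.02678 Rougerie's survey); crossref: "Villain model long-range order
duality" (10, none relevant beyond physics), "Massless phases and symmetry restoration…" →
doi:10.1007/bf01213610 (FrohlichSpencerCMP1982), "continuous symmetry breaking Nishimori line" →
doi:10.1063/5.0087024 (GarbanSpencer2022, added to bib), "XY model non-uniformly elliptic" →
doi:10.1007/s00220-025-05269-7 (DarioGarban2025, added), "nonconfining phase four-dimensional U(1)"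
→ doi:10.1103/physrevd.21.2291 (Guth1980), "abelian Higgs Kennedy King" → doi:10.1007/bf01211599,
"Wallin Sorensen Girvin Young" → doi:10.1103/physrevb.49.12115, "quantum rotor long-range order
ground state reflection positivity" (3, nothing rigorous beyond Wojtkiewicz2012 known to the card).
Plus the card's own search log and TWO refuter novelty audits (audit-3, audit-14, 2026-08-15:
crossref/zbMATH/hybrid; added GarbanSpencer2022 and Aizenman–Harel–Peled–Shapiro 2021 as alternative
engines; verdict new-combination).
Nearest prior art found: FrohlichSpe  [refs: 10.1007/bf01213610, 10.1063/5.0087024, 10.1007/s00220-025-05269-7, 10.1103/physrevd.21.2291, 10.1007/bf01211599, 10.1103/physrevb.49.12115, 2603.20776, 2510.20493, 2602.16566, 2002.02678, doi:10.1007/bf01213610, doi:10.1063/5.0087024, doi:10.1007/s00220-025-05269-7, doi:10.1103/physrevd.21.2291, doi:10.1007/bf01211599, doi:10.1103/physrevb.49.12115, Junge2026, ChongLiangNam2026, FrohlichSpencerCMP]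

Barriers (technique_class: duality,Peierls,coarse-graining,current-representation): - technique_class: duality,Peierls,coarse-graining,current-representation
- Literature.Barriers.AtomisticToContinuum.BogoliubovPerturbationInfrared: evaded for the order
parameter — beyond scale ℓ nothing is expanded around Bogoliubov; the expansion parameter is the
sheet fugacity e^{−cK}, and the marginal d = 3 logarithms live in amplitude correlations that
block-LRO does not need. Honest: it re-enters INSIDE HealingScaleTransfer (one super-renormalisable
step; the large-field/positivity issue of the Schur complement is the bet, kill K2).
- Literature.Barriers.AtomisticToContinuum.KineticGapLengthScales: used only inside cells of side ℓ
= C_L(ρa³)^{−δ}(ρa)^{−1/2}, exactly the window where it is a (proved) theorem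
(Fournais2020_condensation_holds); inter-cell coherence comes from the engine, which has no gap and
no ℓ² loss. The barrier's decl LSSY2005_thm51_periodic is a cousin input, never applied at L =
(N/ρ)^{1/3}.
- Literature.Barriers.AtomisticToContinuum.HalfFillingReflectionPositivity: evaded — no reflection
positivity anywhere; VillainCurrentLRO is stated for inhomogeneous stiffness precisely so that its
proof must be the RP-free duality/Peierls (or synchronisation) argument; commensurate filling is not
needed because n̄ ≫ 1 (rotor regime).
- Literature.Barriers.AtomisticToContinuum.FeynmanCyclesVersusCondensation: evaded — the order
parameter is the OPEN-worm two-point function (= γ(x,y), Penrose–Onsager), never a cycle-length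
statistic.
- Literature.Barriers.Atomist

History (route lifecycle, newest last):
- 2026-08-15T13:41:05Z · CLOSED retired — not-a-thesis: assembly does not conclude the sub-problem Statement (operator:999:1257524)

sub-problem: BoseEinsteinCondensation · status: closed(retired) · opened planner-plancard-AtomisticToContinuum-BoseEin-c4376ad1-0 2026-08-15T11:19:23Z · rev 0 · ledger route-AtomisticToContinuum-BECVortexSheetDuality
GENERATED by the gate from the ledger (D-0016/17). Provers cite these decls: `theorem foo : Summit.AtomisticToContinuum.BoseEinsteinCondensation.Theses.BECVortexSheetDuality.<Decl> := …` in Summits/AtomisticToContinuum/BoseEinsteinCondensation/Theorems/<Name>.lean.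
-/

namespace Summit.AtomisticToContinuum.BoseEinsteinCondensation.Theses.BECVortexSheetDuality

open scoped BigOperators Topology Manifold Classical MeasureTheory ProbabilityTheory Matrix InnerProductSpace ComplexConjugate ContinuousMap
open Filter Set Function TopologicalSpace MeasureTheory

attribute [summit_statement] _root_.BoseEinsteinCondensation

/-- item stmt-AtomisticToContinuum-3526 · crux · rank 2 · closed · moot by None · by planner
why it might fail: No reflection positivity for inhomogeneous κ; duality+Peierls (FS82, Guth, Kennedy–King) is printed only for homogeneous isotropic models, so Λ- and anisotropy-uniform constants are unproved; Ginibre monotonicity, which would reduce to the homogeneous case, is not known for Villain weights.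
sources: FrohlichSpencerCMP1982, Guth1980, KennedyKing1986, GarbanSpencer2022, DarioGarban2025, FrohlichSimonSpencer1976
[crux] ENGINE (Literature-grade, independent of the Bose gas; card item B2 widened to what a
one-step coarse-graining produces). For every inhomogeneity ratio Λ ≥ 1 there are K₀, c > 0 such
that for all M, T, every direction-wise base stiffness K_i ≥ K₀ (i ∈ Fin 4; arbitrary anisotropy
between directions) and every bond stiffness field κ with K_i ≤ κ_{x,i} ≤ ΛK_i, the Villain
integer-current model on (ℤ/(M+1))³ × ℤ/(T+1) (weights Π exp(−J_{x,i}²/(2κ_{x,i})), divergence Σ_i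
(J_{x,i} − J_{x−e_i,i})) satisfies Σ_{x,y ∈ (ℤ/(M+1))³} Z(δ_{(x,0)} − δ_{(y,0)}) ≥ c (M+1)⁶ Z(0).
Z(q) = sum over currents of divergence q, an ENNReal tsum; Z(0) ∈ [1, ∞). Stiffness is required
large in EVERY direction, so each time-slab is already an ordered 3-D Villain model and no T → ∞
ordering of limits arises (T+1 = 1 is the 3-D model of FrohlichSpencerCMP1982). Stated for
n-INDEPENDENT κ on purpose: n-dependent "Villain sandwiches" are refutable (parity-modulated weights
dualise to XY × a ℤ₂ loop gas of K-independent fugacity 1/√Λ, disordered in 4-D for Λ ≳ 45 — pair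
superfluid without worm LRO; planner's NOTES). [difficulty: L] -/
@[route_item "route-AtomisticToContinuum-BECVortexSheetDuality"]
def VillainCurrentLRO : Prop :=
  ∀ Λ : ℝ, 1 ≤ Λ → ∃ K₀ c : ℝ, 0 < c ∧ ∀ (M T : ℕ) (Kd : Fin 4 → ℝ), (∀ i, K₀ ≤ Kd i) → ∀ κ : ((Fin 3 → ZMod (M + 1)) × ZMod (T + 1)) → Fin 4 → ℝ, (∀ x i, Kd i ≤ κ x i ∧ κ x i ≤ Λ * Kd i) → let Z : (((Fin 3 → ZMod (M + 1)) × ZMod (T + 1)) → ℤ) → ENNReal := fun q => ∑' J : ((Fin 3 → ZMod (M + 1)) × ZMod (T + 1)) → Fin 4 → ℤ, if (∀ x, (∑ k : Fin 3, (J x k.castSucc - J (x.1 - Pi.single k 1, x.2) k.castSucc)) + (J x (Fin.last 3) - J (x.1, x.2 - 1) (Fin.last 3)) = q x) then ∏ x, ∏ i, ENNReal.ofReal (Real.exp (-((J x i : ℝ) ^ 2 / (2 * κ x i)))) else 0; ENNReal.ofReal c * ((M + 1 : ENNReal) ^ 6) * Z 0 ≤ ∑ x : Fin 3 → ZMod (M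 + 1), ∑ y : Fin 3 → ZMod (M + 1), Z (fun z => (if z = (x, 0) then 1 else 0) - (if z = (y, 0) then 1 else 0))

/-- item stmt-AtomisticToContinuum-3527 · crux · rank 3 · closed · moot by None · by planner
why it might fail: Integrating out intra-cell modes (Schur complement) need not keep cell-current weights POSITIVE and bondwise-Villain: complex weights at relative order (ξ/ℓ)² return BFKT's large-field problem; cell gap c/ℓ ≈ Josephson frequency gives temporal memory; Neumann-cell BEC (Junge2026) not vendored.
sources: BalabanEtAl2010, Benfatto1994, WallinEtAl1994, Fournais2020, LiebSeiringerSolovejYngvason2005, Junge2026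
[crux] THE BET (card items B1 + B3, stated conditionally so the assembly is pure logic):
VillainCurrentLRO ⇒ PeriodicBEC (body verbatim = BECPeriodicReduction.PeriodicBEC,
stmt-AtomisticToContinuum-0826: ∀ repulsive finite-range v ∃ρ₀ ∀ρ<ρ₀ ∃c ∀ᶠN ∃δ, every
δ-near-minimiser of periodicEnergy on the torus of side (N/ρ)^{1/3} has condensateOccupation ≥ cN).
Intended proof: (i) coarse-grain the imaginary-time periodic gas (ground state = β → ∞ at fixed N, L
first) into M³ cells of Fournais side ℓ = C_L(ρa³)^{−δ}(ρa)^{−1/2}, M = L/ℓ → ∞, and time-slabs τ₀ =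
θ(E_J E_C)^{−1/2} (E_J ≍ ρℓ Josephson coupling per face, E_C ≍ 8πa/ℓ³ charging energy; mean
occupation n̄ = ρℓ³ = C_L³(ρa³)^{−1/2−3δ} ≫ 1, rotor regime) — cell charges and face-crossing counts
are a conserved integer current whose law is a POSITIVE push-forward of the Feynman–Kac/occupation
measure; (ii) show its weights are bondwise Villain with stiffnesses K_s = E_Jτ₀, K_t = 1/(E_Cτ₀),
K_sK_t = K² ≍ (8π)^{−1}C_L⁴(ρa³)^{−1−4δ}, up to corrections that keep the class of VillainCurrentLRO
(inputs, all PROVED in the tree: Fournais2020_condensation_holds for intra-cell condensation,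
LSSY2005_lemma52_periodic_holds / LSSY2005_lowerBound_ -/
@[route_item "route-AtomisticToContinuum-BECVortexSheetDuality"]
def HealingScaleTransfer : Prop :=
  VillainCurrentLRO → ∀ v : ℝ → ENNReal, Literature.MathematicalPhysics.QuantumManyBody.BoseGas.IsRepulsiveFiniteRange v → ∃ ρ₀ : ℝ, 0 < ρ₀ ∧ ∀ ρ : ℝ, 0 < ρ → ρ < ρ₀ → ∃ c : ℝ, 0 < c ∧ ∀ᶠ N : ℕ in Filter.atTop, ∃ δ : ENNReal, 0 < δ ∧ ∀ Ψ : Literature.MathematicalPhysics.QuantumManyBody.BoseGas.PeriodicTrialState N (Literature.MathematicalPhysics.QuantumManyBody.BoseGas.sideLength ρ N), Literature.MathematicalPhysics.QuantumManyBody.BoseGas.periodicEnergy v Ψ ≤ Literature.MathematicalPhysics.QuantumManyBody.BoseGas.periodicGroundStateEnergy v N (Literature.MathematicalPhysics.QuantumManyBody.BoseGas.sideLength ρ N) + δ → ENNReal.ofReal (c * N) ≤ Literature.MathematicalPhysics.QuantumManyBody.BoseGas.condensateOccupation N (Literature.MathematicalPhysics.QuantumManyBody.BoseGas.sideLength ρ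 N) Ψ.ψ

/-- item stmt-AtomisticToContinuum-0827 · crux · rank 4 · open · by planner
why it might fail: PeriodicBEC(v) is ground-state-only at the box (N/ρ)^{1/3}: the Dirichlet ground state is a periodic trial state but lies a wall term ≫ δ above E₀^per and interior restrictions are neither periodic nor of sharp N, so the hypothesis may never fire; BEC is BC-sensitive (Robinson1976).
sources: LiebSeiringerSolovejYngvason2005, Junge2026, Basti2022, BoccatoSeiringer2023, Robinson1976, LauwersVerbeureZagrebnov2003
[crux] BoundaryTransferWeak (mode-free boundary-condition transfer, per potential): for each
repulsive finite-range v, PeriodicBEC(v) implies ∃ρ₀>0 ∀ρ∈(0,ρ₀) HasGroundStateBEC v ρ (Dirichlet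
ground state, λ_max(γ) ≥ cN via condensateNumber). Not glue: near-minimiser slacks are O(N/L²) while
Dirichlet/periodic energies differ by a boundary term ≫ N/L², so no energy-comparison proof;
expected route: Neumann bracketing of interior sub-boxes (−Δ_Dir ≥ ⊕−Δ_Neu, v ≥ 0) + a mode-free
criterion (λ_max ≥ tr γ²/N). Only the ENERGY analogue is in print (LiebSeiringerSolovejYngvason2005
Ch. 2 after (2.8)). v ≡ 0: hypothesis and conclusion both true. -/
@[route_item "route-AtomisticToContinuum-BECVortexSheetDuality"]
def BoundaryTransferWeak : Prop :=
  ∀ v : ℝ → ENNReal, Literature.MathematicalPhysics.QuantumManyBody.BoseGas.IsRepulsiveFiniteRange v → (∃ ρ₀ : ℝ, 0 < ρ₀ ∧ ∀ ρ : ℝ, 0 < ρ → ρ < ρ₀ → ∃ c : ℝ, 0 < c ∧ ∀ᶠ N : ℕ in Filter.atTop, ∃ δ : ENNReal, 0 < δ ∧ ∀ Ψ : Literature.MathematicalPhysics.QuantumManyBody.BoseGas.PeriodicTrialState N (Literature.MathematicalPhysics.QuantumManyBody.BoseGas.sideLength ρ N), Literature.MathematicalPhysics.QuantumManyBody.BoseGas.periodicEnergy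 v Ψ ≤ Literature.MathematicalPhysics.QuantumManyBody.BoseGas.periodicGroundStateEnergy v N (Literature.MathematicalPhysics.QuantumManyBody.BoseGas.sideLength ρ N) + δ → ENNReal.ofReal (c * N) ≤ Literature.MathematicalPhysics.QuantumManyBody.BoseGas.condensateOccupation N (Literature.MathematicalPhysics.QuantumManyBody.BoseGas.sideLength ρ N) Ψ.ψ) → ∃ ρ₀ : ℝ, 0 < ρ₀ ∧ ∀ ρ : ℝ, 0 < ρ → ρ < ρ₀ → Literature.MathematicalPhysics.QuantumManyBody.BoseGas.HasGroundStateBEC v ρ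

/-- item stmt-AtomisticToContinuum-3528 · support · rank 9 · closed · moot by None · by planner
sources: FrohlichSpencerCMP1982, Guth1980, KennedyKing1986, Wojtkiewicz2012
[support] MILESTONE 0 of the engine (the Λ = 1, translation-invariant case; Sketch.lean proves
VillainCurrentLRO → HomogeneousVillainLRO): for direction-wise constant stiffnesses K_i ≥ K₀
(anisotropy free) the (3+1)-D Villain current model has the same uniform equal-time block long-range
order. Closest to print: FrohlichSpencerCMP1982 (d ≥ 3 isotropic Villain, duality + energy–entropy
of defects), Guth1980 (the dual 4-D U(1) statement); the anisotropy-uniform bookkeeping (every slab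
ordered because every K_i ≥ K₀) is the only addition. A prover may land it as a Literature fact +
proof under Literature/Probability/LatticeModels and cite it here. [difficulty: L] -/
@[route_item "route-AtomisticToContinuum-BECVortexSheetDuality"]
def HomogeneousVillainLRO : Prop :=
  ∃ K₀ c : ℝ, 0 < c ∧ ∀ (M T : ℕ) (Kd : Fin 4 → ℝ), (∀ i, K₀ ≤ Kd i) → let Z : (((Fin 3 → ZMod (M + 1)) × ZMod (T + 1)) → ℤ) → ENNReal := fun q => ∑' J : ((Fin 3 → ZMod (M + 1)) × ZMod (T + 1)) → Fin 4 → ℤ, if (∀ x, (∑ k : Fin 3, (J x k.castSucc - J (x.1 - Pi.single k 1, x.2) k.castSucc)) + (J x (Fin.last 3) - J (x.1, x.2 - 1) (Fin.last 3)) = q x) then ∏ x, ∏ i, ENNReal.ofReal (Real.exp (-((J x i : ℝ) ^ 2 / (2 * Kd i)))) else 0; ENNReal.ofReal c * ((M + 1 : ENNReal) ^ 6) * Z 0 ≤ ∑ x : Fin 3 → ZMod (M + 1), ∑ y : Fin 3 → ZMod (M + 1), Z (fun z => (if z = (x, 0) then 1 else 0) - (if z = (y, 0) then 1 else 0))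

/-- item stmt-AtomisticToContinuum-3529 · assembly · rank 1 · closed · moot by None · by planner
sources: LiebSeiringerSolovejYngvason2005, FrohlichSpencerCMP1982
[assembly] VillainCurrentLRO → HealingScaleTransfer → BoundaryTransferWeak →
BoseEinsteinCondensation (proof: fun h2 h3 h4 v hv => h4 v hv (h3 h2 v hv)). -/
@[route_item "route-AtomisticToContinuum-BECVortexSheetDuality"]
def Assembly : Prop :=
  VillainCurrentLRO → HealingScaleTransfer → BoundaryTransferWeak → Literature.MathematicalPhysics.QuantumManyBody.BoseGas.BoseEinsteinCondensation

end Summit.AtomisticToContinuum.BoseEinsteinCondensation.Theses.BECVortexSheetDuality
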